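import Literature.AnabelianGeometry.AbsoluteAnabelian.AbsTopII.InertiaGroupsScope

/-!
# [AbsTopII] Prop 1.3 (x) PER LOG POINT and for the model's FAMILY of log points (`Prop_1_3_x''`)

S. Mochizuki, *Topics in Absolute Anabelian Geometry II* [AbsTopII] (bib `MochizukiAbsTopII2013`;
locators = PDF pages of the kurims manuscript `paper:url-585b8d0ad0d9`), §1, Def 1.2 (ii) p. 10,
Prop 1.3 (x) p. 12:

> "(x) Let `τ_I : I → Π_I` be the [outer] homomorphism that arises [by functoriality!] from a 'log
> point' `τ_S ∈ X^{log}(S^{log})`.  Let us call `τ_I` non-verticial (respectively, non-edge-like) if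
> `τ_I(I)` is not contained in `I_v` (respectively, `I_e`) for any vertex `v` (respectively, edge `e`)
> of `𝔾`.  Then if `τ_I` is non-verticial and non-edge-like, then the image of `τ_S` is the unique cusp
> `e_τ` of `X` such that [for an appropriate choice of conjugate of `D_{e_τ}`] `τ_I(I) ⊆ D_{e_τ}`.  Now
> suppose that the image of `τ_S` is not a cusp.  Then `τ_I` satisfies the condition `τ_I(I) = I_{v_τ}`
> for some vertex `v_τ` of `𝔾` [and an appropriate choice of conjugate of `I_{v_τ}`] if and only if the
> image of `τ_S` is a non-nodal point of the irreducible component of `X` corresponding to `v_τ`; `τ_I`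
> is non-verticial and satisfies the condition `τ_I(I) ⊆ I_{e_τ}` for some node `e_τ` of `𝔾` [and an
> appropriate choice of conjugate of `I_{e_τ}`] if and only if the image of `τ_S` is the node of `X`
> corresponding to `e_τ`."

Statements file (2 predicates), abc-iut-L4-t6 lineage (typer of record of Prop 1.3 (x):
`DPSCIndexData.Prop_1_3_x`, `AbsTopII/InertiaGroups.lean` p405221; `Prop_1_3_x'`,
`AbsTopII/InertiaGroupsScope.lean` p427207), repairing FINDING F-L4t6g6-1 (kernel certificates
`AbsTopII/Prop13xLabelScope.lean`): the v1/v2 predicates quantify `∀ τ : X.LogPointData`, i.e. over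
every section image TOGETHER WITH EVERY LABEL `kind` ("the image of `τ_S` in `X`"), the label being a
free field of the record — so they demand that every labelling of every section be the consistent one,
which is false at every datum of Def 1.2 (ii) with two vertices or a node (relabel the section `I_v`).
In print the image point of `τ_S` is DETERMINED BY the log point; the statement is about the log points
of `X^{log}(S^{log})`, each carrying its section `τ_I(I)` and its image point.  Accordingly:

* `LogPointData.Prop13x τ` — the printed clauses for ONE labelled section `τ` (`Π_𝔾`-conjugacy scope,
  erratum E-L4-9 convention, as in `Prop_1_3_x'`);
* `Prop_1_3_x'' X pt` — Prop 1.3 (x) for a FAMILY `pt : L → X.LogPointData` of log points supplied by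
  the model (`L` = the log points `τ_S ∈ X^{log}(S^{log})`, `pt τ_S` = (`τ_I(I)`, image point of
  `τ_S`)): every member satisfies `Prop13x`.  The over-strong v2 predicate is the special case
  `pt = id` (`Prop_1_3_x' X ↔ ∀ τ, τ.Prop13x`, companion file), which is how it is refuted.
The record type `LogPointData`, `PointKind`, `IsNonVerticial`, `IsNonEdgeLike` of the v1 file are
reused unchanged.  HONEST FRAMING: a PREDICATE on abstract DPSC data and a supplied family of labelled
sections, asserted by print for the data of Def 1.2 (ii) with its genuine log points; typed ≠ proved;
nothing here bears on [IUTchIII] Cor 3.12.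
-/

open scoped Pointwise

universe u

namespace Literature.AnabelianGeometry.AbsoluteAnabelian.AbsTopII

namespace DPSCIndexData

variable {X : DPSCIndexData.{u}}

/-- **Prop 1.3 (x) p. 12 for ONE log point**, recorded by its labelled section `τ` = (`τ_I(I)`, image
point of `τ_S`): "if `τ_I` is non-verticial and non-edge-like, then the image of `τ_S` is the unique cusp
`e_τ` of `X` such that [for an appropriate choice of (`Π_𝔾`-)conjugate of `D_{e_τ}`] `τ_I(I) ⊆ D_{e_τ}`.
Now suppose that the image of `τ_S` is not a cusp.  Then `τ_I(I) = I_{v_τ}` [appropriate `Π_𝔾`-conjugate]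
if and only if the image of `τ_S` is a non-nodal point of the irreducible component corresponding to
`v_τ`; `τ_I` is non-verticial and `τ_I(I) ⊆ I_{e_τ}` [appropriate `Π_𝔾`-conjugate] if and only if the
image of `τ_S` is the node corresponding to `e_τ`."  (Clauses verbatim those of `Prop_1_3_x'`, for the
single `τ`.) [cite: MochizukiAbsTopII2013, Prop 1.3 (x) p.12] -/
def LogPointData.Prop13x (τ : X.LogPointData) : Prop :=
  (τ.IsNonVerticial → τ.IsNonEdgeLike →
    ∃ e : X.Cusp, τ.kind = PointKind.cusp e ∧
      ∀ e' : X.Cusp,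
        (∃ γ : X.PiH, γ ∈ X.PiG ∧ τ.image ≤ MulAut.conj γ • X.DvCusp e') ↔ e' = e) ∧
  ((∀ e : X.Cusp, τ.kind ≠ PointKind.cusp e) →
    (∀ v : X.Vert,
      (∃ γ : X.PiH, γ ∈ X.PiG ∧ τ.image = MulAut.conj γ • X.Iv v) ↔ τ.kind = PointKind.smooth v) ∧
    (∀ e : X.Node,
      (τ.IsNonVerticial ∧ ∃ γ : X.PiH, γ ∈ X.PiG ∧ τ.image ≤ MulAut.conj γ • X.IvNode e) ↔
        τ.kind = PointKind.node e))

variable (X) in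
/-- **Prop 1.3 (x) p. 12 for THE LOG POINTS OF THE MODEL** (v3 of the typing; finding F-L4t6g6-1): for a
family `pt : L → X.LogPointData` of log points — `L` the set of log points `τ_S ∈ X^{log}(S^{log})`,
`pt τ_S` its section `τ_I(I) ⊆ Π_I` together with the image point of `τ_S` in `X` (a cusp, a non-nodal
point of the component `v`, or a node) — every member satisfies the printed clauses (`Prop13x`).  The
family is a datum of the model (Def 1.2 (ii): a stable log curve over a log point), not the type of all
labelled sections; supersedes `Prop_1_3_x` / `Prop_1_3_x'` for consumers.
[cite: MochizukiAbsTopII2013, Prop 1.3 (x) p.12] -/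
def Prop_1_3_x'' {L : Type u} (pt : L → X.LogPointData) : Prop :=
  ∀ l : L, (pt l).Prop13x

end DPSCIndexData

end Literature.AnabelianGeometry.AbsoluteAnabelian.AbsTopII
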